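import Summits.KontsevichZagierPeriods.Zeta5Search.Barrier.ConeGammaDefs
import HarnessLib

/-!
# ζ(5) search — BARRIER (i): the growth functional, critical values `C₁`, `C₀`, the rate function `γ`, the statement

HONEST FRAMING (cell `pub-zeta5`): systematic search; no irrationality claim unless kernel-certified. Everything here is the
MODEL — closed-form rates under Brown–Zudilin's own denominator accounting ((28) is an «experimental observation» of
[BZ22] = arXiv:2210.03391, p. 20; (29)–(30) rides on it); nothing is a theorem about `ζ(5)`; every `γ` the cell has
computed is `< 1` (no irrationality content); records in print UNMOVED. A «barrier» is a statement about a METHOD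
CLASS (BZ's 8-fold cellular box with lcm-type denominator laws), CONDITIONAL on NAMED accounting hypotheses — not a
theorem that `ζ(5)`-approximations cannot exist. Sources: census kernel `census_bz_gamma.py` (sha256 8972266e…) as
transcribed in the cell's `BARRIER-FORMULAS.md` (c7e5c80b…); coordinator's REFINED STRUCTURE TARGET 2026-08-23,
clause (i) «formalise γ(direction)»; cell file `BARRIER-PLAN.md` §1 (theory seat cert-2 g16).

This file (2/5):
* `pR`, `qR`, `F1R`, `F2R` — real-parameter (11) and the §5 system (bridges `pR_realDir`, `F1R_intCast`, … to the
  Literature `pOf/qOf/F₁/F₂`); `critFactors` (the twelve `(x,y)`-arguments of the growth functional), `critExps` (signed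
  exponents; `p₂+q₂` on `|p₂+q₂−x|` — the v3 display's `p₁+q₂` is a misprint; `critExps_sum`: the exponents sum to
  `0`), `constArgs`, `growthLogR` (= `BrownZudilin2022.growthLog` on integer parameters, `growthLog_eq_growthLogR`);
  `growthLogR_smul` — degree-1 homogeneity wherever the twelve arguments are non-zero.
* `IsCritical a x y` (`F₁ = F₂ = 0`, twelve arguments `≠ 0` — excludes the trivial solutions of (19)), `critVals a`;
  **sSup-FORM**: `C1 := sSup critVals` (= `log λ₃`), `C0 := sSup (critVals ∖ {C1})` (second largest, = `log|λ₂|`),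
  `lam1 := sInf`; `Regular a` — exactly three critical values (census status `ok`; `γ` is NOT a number of record
  elsewhere). WHY sSup-form: the cubic (20) with coefficients polynomial in `a` is not printed and exists in the tree
  only ray by ray; the sSup over the explicit critical set is what ray chains and interval enclosures bound.
  `critVals_smul`, `C1_smul`, `C0_smul`, `lam1_smul`, `regular_smul`, `C0_le_C1`.
* `gamma a := (C1 − C0)/(C1 + delta28 − phi30)` (BZ §11), **`gamma_smul`** (direction function), `extraSaving`
  (`S* = δ₂₈ − Φ − |C₀|` = census Δ), `gammaWith`, `gamma_lt_one_iff`, `one_sub_gamma`, `one_lt_gammaWith_iff`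
  (clause (iii): `γ_S > 1 ⇔ S > S*`), `frac_le_of_bounds` / `gamma_le_of_bounds` (the audit lane's per-box bound
  `γ_upper(B)`, BARRIER-PLAN §2 ii.2), and THE STATEMENT `ConeSupBound γ* := ∀ a ∈ BZCone, Regular a → gamma a ≤ γ*`
  (a Prop; any certificate lives at PAPER grade with its hash in BARRIER-PLAN; `coneSupBound_iff_height_one`).
-/

noncomputable section

open Finset MeasureTheory Set Filter
open scoped Topology Pointwise

namespace Summit.KontsevichZagierPeriods.Zeta5Search.Barrier.ConeGamma

open Literature.NumberTheory.Irrationality.BrownZudilin2022 (pOf qOf F₁ F₂ growthLog)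

/-! ### The asymptotic system (§5): real-parameter `(p;q)`, `F₁`, `F₂`, the growth functional, critical values -/

/-- `p = (p₀,…,p₆)` of (11) for a real direction (as `BrownZudilin2022.pOf`). -/
def pR (a : Dir) : Fin 7 → ℝ :=
  ![a 4 + a 5 - a 7, a 1 + a 2 + a 5 - a 3 - a 7, a 5, a 1 + a 2 + a 5 - a 7, a 6,
    a 2 + a 5 - a 7, a 0 + a 1 + a 5 - a 3 - a 7]

/-- `q = (q₁,…,q₅)` of (11) for a real direction (as `BrownZudilin2022.qOf`; entry `j` is `q_{j+1}`). -/
def qR (a : Dir) : Fin 5 → ℝ := ![a 3, a 4, a 0 + a 4 - a 2, a 0, a 1]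

/-- `pR`, `qR` are linear. -/
theorem pR_smul (t : ℝ) (a : Dir) : pR (t • a) = t • pR a := by
  simp [pR, smul_eq_mul, mul_add, mul_sub]

/-- `qR` is linear. -/
theorem qR_smul (t : ℝ) (a : Dir) : qR (t • a) = t • qR a := by
  simp [qR, smul_eq_mul, mul_add, mul_sub]

/-- `pR`, `qR` agree with the Literature `pOf`, `qOf` on integer vectors. -/
theorem pR_realDir (a : Fin 8 → ℤ) : pR (realDir a) = fun i => (pOf a i : ℝ) := by
  ext i; fin_cases i; all_goals simp [pR, pOf, realDir]

/-- `qR` agrees with the Literature `qOf` on integer vectors. -/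
theorem qR_realDir (a : Fin 8 → ℤ) : qR (realDir a) = fun i => (qOf a i : ℝ) := by
  ext i; fin_cases i; all_goals simp [qR, qOf, realDir]

/-- `F₁(x,y)` of §5 with real parameters. -/
def F1R (p : Fin 7 → ℝ) (q : Fin 5 → ℝ) (x y : ℝ) : ℝ :=
  x * (p 1 + q 0 - x) * (p 2 + q 1 - x) * (x + y + q 2 - p 0 - p 6)
    - (x - p 0) * (x - p 1) * (x - p 2) * (x + y - p 3)

/-- `F₂(x,y)` of §5 with real parameters. -/
def F2R (p : Fin 7 → ℝ) (q : Fin 5 → ℝ) (x y : ℝ) : ℝ :=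
  (x + y + q 2 - p 0 - p 6) * (p 4 + q 3 - y) * (p 5 + q 4 - y) * y
    - (x + y - p 3) * (y - p 4) * (y - p 5) * (y - p 6)

/-- Bridges to the Literature definitions (integer parameters). -/
theorem F1R_intCast (p : Fin 7 → ℤ) (q : Fin 5 → ℤ) (x y : ℝ) :
    F1R (fun i => (p i : ℝ)) (fun i => (q i : ℝ)) x y = F₁ p q x y := by
  simp [F1R, F₁]

/-- Bridge for `F₂` (integer parameters). -/
theorem F2R_intCast (p : Fin 7 → ℤ) (q : Fin 5 → ℤ) (x y : ℝ) :
    F2R (fun i => (p i : ℝ)) (fun i => (q i : ℝ)) x y = F₂ p q x y := by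
  simp [F2R, F₂]

/-- `F₁`, `F₂` are products of linear forms in `(x,y,p,q)`, homogeneous of degree 4. -/
theorem F1R_smul (t : ℝ) (p : Fin 7 → ℝ) (q : Fin 5 → ℝ) (x y : ℝ) :
    F1R (t • p) (t • q) (t * x) (t * y) = t ^ 4 * F1R p q x y := by
  simp only [F1R, Pi.smul_apply, smul_eq_mul]; ring

/-- `F₂` is homogeneous of degree 4. -/
theorem F2R_smul (t : ℝ) (p : Fin 7 → ℝ) (q : Fin 5 → ℝ) (x y : ℝ) :
    F2R (t • p) (t • q) (t * x) (t * y) = t ^ 4 * F2R p q x y := by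
  simp only [F2R, Pi.smul_apply, smul_eq_mul]; ring

/-- The twelve `(x,y)`-dependent linear arguments of the growth functional, in printed order:
`x−p₀, x−p₁, x−p₂, x+y−p₃, p₁+q₁−x, p₂+q₂−x, x+y+q₃−p₀−p₆, y−p₄, y−p₅, y−p₆, p₄+q₄−y, p₅+q₅−y`. -/
def critFactors (p : Fin 7 → ℝ) (q : Fin 5 → ℝ) (x y : ℝ) : Fin 12 → ℝ :=
  ![x - p 0, x - p 1, x - p 2, x + y - p 3, p 1 + q 0 - x, p 2 + q 1 - x, x + y + q 2 - p 0 - p 6,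
    y - p 4, y - p 5, y - p 6, p 4 + q 3 - y, p 5 + q 4 - y]

/-- Their SIGNED exponents `p₀, p₁, p₂, p₃, −(p₁+q₁), −(p₂+q₂), −(p₀+p₆−q₃), p₄, p₅, p₆, −(p₄+q₄), −(p₅+q₅)`.
Faithfulness note (BARRIER-FORMULAS §2): the exponent of `|p₂+q₂−x|` is `p₂+q₂` (the v3 display prints `p₁+q₂`,
a misprint; `p₂+q₂` reproduces every printed value and is the unique choice making all exponents sum to `0`,
`critExps_sum`), as in K l.174 and the tree's `BrownZudilin2022.growthLog`. -/
def critExps (p : Fin 7 → ℝ) (q : Fin 5 → ℝ) : Fin 12 → ℝ :=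
  ![p 0, p 1, p 2, p 3, -(p 1 + q 0), -(p 2 + q 1), -(p 0 + p 6 - q 2), p 4, p 5, p 6, -(p 4 + q 3), -(p 5 + q 4)]

/-- The seven constant arguments `q₁, q₂, q₄, q₅, p₀, p₃+q₃−p₀−p₆, p₆` (each its own exponent) … -/
def constArgs (p : Fin 7 → ℝ) (q : Fin 5 → ℝ) : Fin 7 → ℝ :=
  ![q 0, q 1, q 3, q 4, p 0, p 3 + q 2 - p 0 - p 6, p 6]

/-- … with signs `+,+,+,+,−,−,−`. -/
def constSigns : Fin 7 → ℝ := ![1, 1, 1, 1, -1, -1, -1]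

/-- **The growth functional** `log|λ(x,y)|` of §5 (display p. 12) with real parameters:
`Σ_k e_k log|v_k(x,y)| + Σ_k ±c_k log c_k`. Equal to `BrownZudilin2022.growthLog` on integer parameters
(`growthLog_eq_growthLogR`). Mathlib's `Real.log 0 = 0` realises K's convention `0·log 0 = 0` for the constants. -/
def growthLogR (p : Fin 7 → ℝ) (q : Fin 5 → ℝ) (x y : ℝ) : ℝ :=
  (∑ k, critExps p q k * Real.log |critFactors p q x y k|)
    + ∑ k, constSigns k * (constArgs p q k * Real.log (constArgs p q k))

/-- The signed exponents sum to zero identically (this is what makes `log|λ|` degree-1 homogeneous). -/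
theorem critExps_sum (p : Fin 7 → ℝ) (q : Fin 5 → ℝ) :
    (∑ k, critExps p q k) + ∑ k, constSigns k * constArgs p q k = 0 := by
  simp [critExps, constArgs, constSigns, Fin.sum_univ_succ]
  ring

/-- Bridge: the Literature growth functional (integer parameters) is `growthLogR`. -/
theorem growthLog_eq_growthLogR (p : Fin 7 → ℤ) (q : Fin 5 → ℤ) (x y : ℝ) :
    growthLog p q x y = growthLogR (fun i => (p i : ℝ)) (fun i => (q i : ℝ)) x y := by
  simp [growthLog, growthLogR, critExps, critFactors, constArgs, constSigns, Fin.sum_univ_succ]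
  ring

/-- Linear data scale linearly. -/
theorem critFactors_smul (t : ℝ) (p : Fin 7 → ℝ) (q : Fin 5 → ℝ) (x y : ℝ) (k : Fin 12) :
    critFactors (t • p) (t • q) (t * x) (t * y) k = t * critFactors p q x y k := by
  fin_cases k <;> simp [critFactors, smul_eq_mul] <;> ring

/-- The signed exponents are linear in the parameters. -/
theorem critExps_smul (t : ℝ) (p : Fin 7 → ℝ) (q : Fin 5 → ℝ) (k : Fin 12) :
    critExps (t • p) (t • q) k = t * critExps p q k := by
  fin_cases k <;> simp [critExps, smul_eq_mul] <;> ring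

/-- The constant arguments are linear in the parameters. -/
theorem constArgs_smul (t : ℝ) (p : Fin 7 → ℝ) (q : Fin 5 → ℝ) (k : Fin 7) :
    constArgs (t • p) (t • q) k = t * constArgs p q k := by
  have : constArgs (t • p) (t • q) = t • constArgs p q := by
    simp [constArgs, smul_eq_mul, mul_add, mul_sub]
  simp [this]

/-- `(te)·log(te) = t·(e log e) + (t log t)·e` for `t > 0` and EVERY real `e` (both sides vanish at `e = 0`). -/
theorem mul_log_mul_self {t : ℝ} (ht : 0 < t) (e : ℝ) :
    (t * e) * Real.log (t * e) = t * (e * Real.log e) + t * Real.log t * e := by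
  rcases eq_or_ne e 0 with rfl | he
  · simp
  · rw [Real.log_mul ht.ne' he]; ring

/-- `(te)·log|tv| = t·(e log|v|) + (t log t)·e` for `t > 0`, `v ≠ 0`. -/
theorem mul_log_abs_mul {t : ℝ} (ht : 0 < t) (e : ℝ) {v : ℝ} (hv : v ≠ 0) :
    (t * e) * Real.log |t * v| = t * (e * Real.log |v|) + t * Real.log t * e := by
  rw [abs_mul, abs_of_pos ht, Real.log_mul ht.ne' (abs_ne_zero.mpr hv)]; ring

/-- **Homogeneity of the growth functional**: at a point where the twelve arguments are non-zero,
`log|λ|(t·p, t·q; tx, ty) = t · log|λ|(p, q; x, y)` for every real `t > 0`. -/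
theorem growthLogR_smul {t : ℝ} (ht : 0 < t) (p : Fin 7 → ℝ) (q : Fin 5 → ℝ) {x y : ℝ}
    (hv : ∀ k, critFactors p q x y k ≠ 0) :
    growthLogR (t • p) (t • q) (t * x) (t * y) = t * growthLogR p q x y := by
  unfold growthLogR
  simp_rw [critFactors_smul, critExps_smul, constArgs_smul]
  have h1 : ∀ k, (t * critExps p q k) * Real.log |t * critFactors p q x y k|
      = t * (critExps p q k * Real.log |critFactors p q x y k|) + t * Real.log t * critExps p q k :=
    fun k => mul_log_abs_mul ht _ (hv k)
  have h2 : ∀ k, constSigns k * ((t * constArgs p q k) * Real.log (t * constArgs p q k))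
      = t * (constSigns k * (constArgs p q k * Real.log (constArgs p q k)))
        + t * Real.log t * (constSigns k * constArgs p q k) := by
    intro k; rw [mul_log_mul_self ht]; ring
  simp_rw [h1, h2, Finset.sum_add_distrib, ← Finset.mul_sum]
  have h0 := critExps_sum p q
  have : t * Real.log t * ∑ k, critExps p q k + t * Real.log t * ∑ k, constSigns k * constArgs p q k = 0 := by
    rw [← mul_add, h0, mul_zero]
  linarith

/-- A CRITICAL POINT of the direction `a`: a solution of `F₁ = F₂ = 0` at which the twelve arguments of the growth
functional are non-zero (this excludes the trivial solutions `x = 0, y = p₃` and `x = p₃, y = 0` of (19), both of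
which have `x + y − p₃ = 0`, and the points where K's `logvalue` is undefined). -/
def IsCritical (a : Dir) (x y : ℝ) : Prop :=
  F1R (pR a) (qR a) x y = 0 ∧ F2R (pR a) (qR a) x y = 0 ∧ ∀ k, critFactors (pR a) (qR a) x y k ≠ 0

/-- The set of CRITICAL VALUES `log|λ|` of the direction `a` (generically the three numbers (21)). -/
def critVals (a : Dir) : Set ℝ :=
  {v | ∃ x y, IsCritical a x y ∧ v = growthLogR (pR a) (qR a) x y}

/-- **`C₁(a) = log λ₃`**: the largest critical value (= `lim (1/n) log Q(a·n)` by BZ's §5 recipe). sSup-FORM. -/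
def C1 (a : Dir) : ℝ := sSup (critVals a)

/-- `log|λ₁|`: the least critical value (= `lim (1/n) log I(a·n)`). -/
def lam1 (a : Dir) : ℝ := sInf (critVals a)

/-- **`C₀(a) = log|λ₂|`**: the SECOND largest critical value (= `lim (1/n) log|Q(a·n)ζ(5) − P(a·n)|` given
`|λ₁| < |λ₂|`, Remark 2). sSup-FORM. -/
def C0 (a : Dir) : ℝ := sSup (critVals a \ {C1 a})

/-- REGULAR directions: exactly three critical values (census status `ok`). Every other status — `no-zeta5`,
`degenerate-zero-h`, `degenerate-resultant`, `critical-value-undefined`, `complex-critical-values` — is a boundary /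
degenerate stratum on which `γ` is NOT a number of record (inside the positive box: 2 158 of 3 782 350 classes in
band 3–41, none `complex`; BARRIER-FORMULAS §1). -/
def Regular (a : Dir) : Prop := (critVals a).ncard = 3

/-- Critical points scale: `(tx, ty)` is critical for `t·a` iff `(x,y)` is critical for `a` (`t > 0`). -/
theorem isCritical_smul {t : ℝ} (ht : 0 < t) (a : Dir) (x y : ℝ) :
    IsCritical (t • a) (t * x) (t * y) ↔ IsCritical a x y := by
  unfold IsCritical
  rw [pR_smul, qR_smul, F1R_smul, F2R_smul]
  simp_rw [critFactors_smul]
  have ht4 : t ^ 4 ≠ 0 := pow_ne_zero 4 ht.ne'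
  simp [ht4, ht.ne']

/-- The critical values scale: `critVals (t·a) = t · critVals a` (`t > 0`). -/
theorem critVals_smul {t : ℝ} (ht : 0 < t) (a : Dir) : critVals (t • a) = t • critVals a := by
  ext v
  simp only [critVals, Set.mem_setOf_eq, Set.mem_smul_set, smul_eq_mul]
  constructor
  · rintro ⟨x, y, hc, rfl⟩
    have hc' : IsCritical a (x / t) (y / t) := by
      rw [← isCritical_smul ht]
      simpa [mul_div_cancel₀ _ ht.ne'] using hc
    refine ⟨growthLogR (pR a) (qR a) (x / t) (y / t), ⟨x / t, y / t, hc', rfl⟩, ?_⟩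
    rw [← growthLogR_smul ht _ _ hc'.2.2, ← pR_smul, ← qR_smul]
    simp [mul_div_cancel₀ _ ht.ne']
  · rintro ⟨w, ⟨x, y, hc, rfl⟩, rfl⟩
    refine ⟨t * x, t * y, (isCritical_smul ht a x y).mpr hc, ?_⟩
    rw [pR_smul, qR_smul, growthLogR_smul ht _ _ hc.2.2]

/-- `C₁(t·a) = t·C₁(a)`. -/
theorem C1_smul {t : ℝ} (ht : 0 < t) (a : Dir) : C1 (t • a) = t * C1 a := by
  unfold C1
  rw [critVals_smul ht, Real.sSup_smul_of_nonneg ht.le, smul_eq_mul]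

/-- `log|λ₁|(t·a) = t·log|λ₁|(a)`. -/
theorem lam1_smul {t : ℝ} (ht : 0 < t) (a : Dir) : lam1 (t • a) = t * lam1 a := by
  unfold lam1
  rw [critVals_smul ht, Real.sInf_smul_of_nonneg ht.le, smul_eq_mul]

/-- `C₀(t·a) = t·C₀(a)`. -/
theorem C0_smul {t : ℝ} (ht : 0 < t) (a : Dir) : C0 (t • a) = t * C0 a := by
  unfold C0
  rw [C1_smul ht, critVals_smul ht]
  have : t • critVals a \ {t * C1 a} = t • (critVals a \ {C1 a}) := by
    ext v
    simp only [Set.mem_sdiff, Set.mem_smul_set, smul_eq_mul, Set.mem_singleton_iff]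
    constructor
    · rintro ⟨⟨w, hw, rfl⟩, hne⟩
      exact ⟨w, ⟨hw, fun h => hne (by rw [h])⟩, rfl⟩
    · rintro ⟨w, ⟨hw, hne⟩, rfl⟩
      exact ⟨⟨w, hw, rfl⟩, fun h => hne (mul_left_cancel₀ ht.ne' h)⟩
  rw [this, Real.sSup_smul_of_nonneg ht.le, smul_eq_mul]

/-- Regularity is a property of the direction. -/
theorem regular_smul {t : ℝ} (ht : 0 < t) (a : Dir) : Regular (t • a) ↔ Regular a := by
  unfold Regular
  rw [critVals_smul ht]
  have : t • critVals a = (fun v => t * v) '' critVals a := by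
    ext v; simp [Set.mem_smul_set]
  rw [this, Set.ncard_image_of_injective _ (mul_right_injective₀ ht.ne')]

/-! ### `γ`, the margin `S*`, homogeneity, and the barrier statement -/

/-- **The rate function** `γ(a) = (C₁ − C₀)/(C₁ + δ₂₈ − Φ)` (BZ §11; K `gamma_worthiness`; lane `gamma_28`). -/
def gamma (a : Dir) : ℝ := (C1 a - C0 a) / (C1 a + delta28 a - phi30 a)

/-- **The extra saving `S*(a) = δ₂₈ − Φ − |C₀|`** that a NEW denominator law would have to supply (nats per unit
`n`) before `γ` could reach `1` (BARRIER-PLAN §3; K `−margin2_nats`, lane `−mu1`). -/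
def extraSaving (a : Dir) : ℝ := delta28 a - phi30 a - |C0 a|

/-- `γ` with a hypothetical further denominator saving `S` (nats/`n`) on top of (28)+(30). -/
def gammaWith (a : Dir) (S : ℝ) : ℝ := (C1 a - C0 a) / (C1 a + delta28 a - phi30 a - S)

/-- **`γ` is a function of the DIRECTION only**: `γ(t·a) = γ(a)` for every real `t > 0`. -/
theorem gamma_smul {t : ℝ} (ht : 0 < t) (a : Dir) : gamma (t • a) = gamma a := by
  unfold gamma
  rw [C1_smul ht, C0_smul ht, delta28_smul ht.le, phi30_smul ht, ← mul_sub,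
    show t * C1 a + t * delta28 a - t * phi30 a = t * (C1 a + delta28 a - phi30 a) by ring,
    mul_div_mul_left _ _ ht.ne']

/-- `S*` is degree-1 homogeneous (so `S*/δ₂₈` — the census's relative deficit `≈ 0.21` — is a direction function). -/
theorem extraSaving_smul {t : ℝ} (ht : 0 < t) (a : Dir) : extraSaving (t • a) = t * extraSaving a := by
  unfold extraSaving
  rw [C0_smul ht, delta28_smul ht.le, phi30_smul ht, abs_mul, abs_of_pos ht]; ring

/-- **Margin form** (cell-wide): when `C₀ < 0 < C₁ + δ₂₈ − Φ`, `γ < 1 ⇔ S* > 0` (i.e. `|C₀| + Φ < δ₂₈`). -/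
theorem gamma_lt_one_iff {a : Dir} (hC0 : C0 a < 0) (hQ : 0 < C1 a + delta28 a - phi30 a) :
    gamma a < 1 ↔ 0 < extraSaving a := by
  unfold gamma extraSaving
  rw [div_lt_one hQ, abs_of_neg hC0]
  constructor <;> intro h <;> linarith

/-- `1 − γ = S*/(C₁ + δ₂₈ − Φ)` (lane: `γ = 1 + mu1/Q`). -/
theorem one_sub_gamma {a : Dir} (hC0 : C0 a < 0) (hQ : 0 < C1 a + delta28 a - phi30 a) :
    1 - gamma a = extraSaving a / (C1 a + delta28 a - phi30 a) := by
  unfold gamma extraSaving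
  rw [abs_of_neg hC0]
  field_simp
  ring

/-- **Clause (iii) quantified**: with a further saving `S` keeping the denominator exponent positive,
`γ_S > 1 ⇔ S > S*`. -/
theorem one_lt_gammaWith_iff {a : Dir} {S : ℝ} (hC0 : C0 a < 0) (hQ : 0 < C1 a + delta28 a - phi30 a - S) :
    1 < gammaWith a S ↔ extraSaving a < S := by
  unfold gammaWith extraSaving
  rw [one_lt_div hQ, abs_of_neg hC0]
  constructor <;> intro h <;> linarith


/-- `C₀ ≤ C₁` on the regular stratum (second largest ≤ largest). -/
theorem C0_le_C1 {a : Dir} (h : Regular a) : C0 a ≤ C1 a := by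
  unfold Regular at h
  have hfin : (critVals a).Finite := Set.finite_of_ncard_ne_zero (by omega)
  have hlt : 1 < (critVals a).ncard := by omega
  obtain ⟨x, hx, y, hy, hxy⟩ := (Set.one_lt_ncard hfin).mp hlt
  have hne : (critVals a \ {C1 a}).Nonempty := by
    by_cases hxc : x = C1 a
    · exact ⟨y, hy, fun hy' => hxy (hxc.trans (Set.mem_singleton_iff.mp hy').symm)⟩
    · exact ⟨x, hx, fun hx' => hxc (Set.mem_singleton_iff.mp hx')⟩
  unfold C0 C1
  exact csSup_le_csSup hfin.bddAbove hne Set.sdiff_subset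

/-- **The per-box bound of the branch-and-bound (BARRIER-PLAN §2 ii.2), as arithmetic**: from one-sided enclosures
`C₁ ≤ C₁⁺`, `C₀⁻ ≤ C₀`, `D⁻ ≤ δ₂₈ − Φ` with `C₀ ≤ C₁`, `C₁ + D⁻ > 0` and the «μ₁-analogue» condition
`0 ≤ C₀⁻ + D⁻` (i.e. the resulting bound is itself `≤ 1`), one gets `γ ≤ (C₁⁺ − C₀⁻)/(C₁⁺ + D⁻)`. -/
theorem frac_le_of_bounds {C1 C0 D C1p C0m Dm : ℝ} (hC1 : C1 ≤ C1p) (hC0 : C0m ≤ C0) (hD : Dm ≤ D)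
    (hQ : 0 < C1 + Dm) (hord : C0 ≤ C1) (hμ : 0 ≤ C0m + Dm) :
    (C1 - C0) / (C1 + D) ≤ (C1p - C0m) / (C1p + Dm) := by
  have hQ1 : 0 < C1 + D := by linarith
  have hQ2 : 0 < C1p + Dm := by linarith
  rw [div_le_div_iff₀ hQ1 hQ2]
  nlinarith [mul_nonneg (sub_nonneg.2 hD) (sub_nonneg.2 (hC0.trans hord)),
    mul_nonneg (sub_nonneg.2 hC1) (sub_nonneg.2 hD), mul_nonneg (sub_nonneg.2 hC1) hμ,
    mul_nonneg (sub_nonneg.2 hC0) hQ.le, mul_nonneg (sub_nonneg.2 hC0) (sub_nonneg.2 hC1)]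

/-- **Box bound for `γ`**: if on a box of directions `C₁ ≤ C₁⁺`, `C₀⁻ ≤ C₀`, `δ⁻ ≤ δ₂₈`, `Φ ≤ Φ⁺`, with
`C₁ + δ⁻ − Φ⁺ > 0` and `0 ≤ C₀⁻ + δ⁻ − Φ⁺`, then `γ(a) ≤ (C₁⁺ − C₀⁻)/(C₁⁺ + δ⁻ − Φ⁺)` at every REGULAR `a` in
the box — the lane's `γ_upper(B)`; pruning a box at `γ_upper(B) < γ*` is therefore sound for `ConeSupBound γ*`
restricted to that box. -/
theorem gamma_le_of_bounds {a : Dir} (hreg : Regular a) {C1p C0m δm Φp : ℝ} (hC1 : C1 a ≤ C1p)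
    (hC0 : C0m ≤ C0 a) (hδ : δm ≤ delta28 a) (hΦ : phi30 a ≤ Φp) (hQ : 0 < C1 a + δm - Φp)
    (hμ : 0 ≤ C0m + δm - Φp) : gamma a ≤ (C1p - C0m) / (C1p + δm - Φp) := by
  unfold gamma
  have h := frac_le_of_bounds (D := delta28 a - phi30 a) (Dm := δm - Φp) hC1 hC0 (by linarith)
    (by linarith) (C0_le_C1 hreg) (by linarith)
  rw [show C1 a + delta28 a - phi30 a = C1 a + (delta28 a - phi30 a) by ring,
    show C1p + δm - Φp = C1p + (δm - Φp) by ring]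
  exact h

/-- **THE BARRIER STATEMENT (clause (ii))**: `γ ≤ γ*` at every REGULAR direction of the cone. A Prop; v1 of
BARRIER-PLAN records the audit lane's interval branch-and-bound certificate (if and when it exists) by hash at
PAPER grade — no kernel theorem `ConeSupBound γ*` is claimed. The boundary/degenerate strata (`¬ Regular`) are
outside the statement by construction, as they are outside the B&B (lane design, BARRIER-PLAN §2). -/
def ConeSupBound (γs : ℝ) : Prop := ∀ a ∈ BZCone, Regular a → gamma a ≤ γs

/-- The statement is about DIRECTIONS: it suffices to check it on any transversal, e.g. `s₀ = 1`
(the ordered simplex `0 ≤ t₁ ≤ … ≤ t₇ ≤ 1`, `tⱼ = sⱼ/s₀`, after the `S₇` reduction). -/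
theorem coneSupBound_iff_height_one (γs : ℝ) :
    ConeSupBound γs ↔ ∀ a ∈ BZCone, sParam a 0 = 1 → Regular a → gamma a ≤ γs := by
  constructor
  · exact fun h a ha _ hr => h a ha hr
  · intro h a ha hr
    have h0 : 0 < sParam a 0 := ha.1.1
    have hmem := BZCone_smul (inv_pos.mpr h0) ha
    have h1 : sParam ((sParam a 0)⁻¹ • a) 0 = 1 := by
      rw [sParam_smul, Pi.smul_apply, smul_eq_mul, inv_mul_cancel₀ h0.ne']
    have := h _ hmem h1 ((regular_smul (inv_pos.mpr h0) a).mpr hr)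
    rwa [gamma_smul (inv_pos.mpr h0)] at this

/-- **C2 — the cell's HEADLINE CONJECTURE** (coordinator wording, 2026-08-23: «sup over the BZ direction cone of `γ`
under (28)+(30) accounting is `≈ 0.867 (< 1)`»; numerical value re-drawn by the lead the same day after the audit
lane's FLOAT branch-and-bound N1: «float sup `≥ 0.8692`, still `< 1` with the same relative margin `S*/δ₂₈ ≈ 0.21`»),
here in the qualitative form `∃ γ* < 1, ConeSupBound γ*`, which neither wording change affects. OPEN. A MODEL-class
statement about Brown–Zudilin's 8-fold cellular box (its arithmetic meaning is conditional on the named hypotheses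
`Law28`/`Law30` and the identifications of `ConeGammaAccounting.exponent_of_accounting`); NOT a statement about `ζ(5)`,
and `γ < 1` has no irrationality content. Evidence, not proof: ≈ 3.6·10⁷ folded integer classes (census bands 3–60,
`2s₀ ≤ 60`) all `< 0.8672`; [Arb ×2]-certified directions record `0.865971`, class `60;10,…,28` `0.866513`, sealed
argmax-120 `0.867129`; N1's float maximum `0.869236` at class `480; 66,112,136,148,172,184,208` (certification sealed
as P-ARGMAX-2, pending), boundary scans decreasing toward every face; the interval branch-and-bound certificate is the
audit lane's N2 (cell file `BARRIER-PLAN.md` §2), at PAPER grade if and when it exists. [status: open] -/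
@[conjecture] def BarrierC2 : Prop := ∃ γs : ℝ, γs < 1 ∧ ConeSupBound γs


end Summit.KontsevichZagierPeriods.Zeta5Search.Barrier.ConeGamma

end
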